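import Summits.CriticalPhenomena.PercolationContinuityZ3.Theorems.PercNearOneGluingNoHeavyLowerTailForestRayleighClass
import Summits.CriticalPhenomena.PercolationContinuityZ3.Theorems.PercNearOneGluingNoHeavyLowerTailForestRayleighKFour
import HarnessLib

/-!
# Weighted forest negative correlation — `K₄` IV: corollaries on four vertices

From `forestsW_rayleigh_K4` (the Rayleigh property of the edge system `T = {ab,ac,ad,bc,bd,cd}` of
`K₄` on four distinct vertices of any `V`) and the abstract consequences `…ForestRayleighClass`:

* `forestsW_conn_posCorr_K4`: **positive correlation of connection events in the arboreal gas**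
  `Z[p~q]·Z[r~u] ≤ Z·Z[p~q ∧ r~u]` on every graph with (at most) four vertices and every minor of
  it, for all activities and all pairs of vertex pairs — in particular for the 4-cycle with the two
  CROSSING pairs (`H + pq + ru = K₄`), the first case beyond tree-width 2 (memo KCLUSTER-gen87 N2″;
  previously known only by the exhaustive census FB(8));
* `forests_negCorr_K4`: the Grimmett–Winkler / Kahn inequality for uniform forests of every graph
  on four vertices (counting form).

Theorems only; no definitions, no `sorry`.
-/

open Finset SimpleGraph
open scoped Classical

namespace Summit.CriticalPhenomena.PercolationContinuityZ3.Theorems.ForestRayleigh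

variable {V : Type*} [Fintype V] [DecidableEq V]

omit [Fintype V] in
/-- The edge system of `K₄` on four distinct vertices is loop-free. [elementary] -/
theorem K4edges_not_isDiag (a b c d : V) (hab : a ≠ b) (hac : a ≠ c) (had : a ≠ d) (hbc : b ≠ c)
    (hbd : b ≠ d) (hcd : c ≠ d) :
    ∀ x ∈ ({s(a, b), s(a, c), s(a, d), s(b, c), s(b, d), s(c, d)} : Finset (Sym2 V)), ¬x.IsDiag := by
  intro x hx
  simp only [Finset.mem_insert, Finset.mem_singleton] at hx
  rcases hx with rfl | rfl | rfl | rfl | rfl | rfl <;> rw [Sym2.mk_isDiag_iff] <;> assumption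

/-- **Positive correlation of connection events in the arboreal gas on four vertices** (all
activities, every minor): for distinct `a b c d`, disjoint `D ∪ K ⊆ {ab,…,cd}` and vertex pairs
`p q`, `r u` each equal or among the six edges, `Z(D;K)[p~q]·Z(D;K)[r~u] ≤ Z(D;K)·Z(D;K)[p~q ∧ r~u]`.
[memo KCLUSTER-gen86 Thm A + `forestsW_rayleigh_K4`] -/
theorem forestsW_conn_posCorr_K4 (a b c d : V) (hab : a ≠ b) (hac : a ≠ c) (had : a ≠ d)
    (hbc : b ≠ c) (hbd : b ≠ d) (hcd : c ≠ d) (w : Sym2 V → ℝ) (hw : ∀ x, 0 ≤ w x)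
    (D K : Finset (Sym2 V)) (hDK : Disjoint D K)
    (hsub : D ∪ K ⊆ ({s(a, b), s(a, c), s(a, d), s(b, c), s(b, d), s(c, d)} : Finset (Sym2 V))) {p q r u : V}
    (hpq : p = q ∨ s(p, q) ∈ ({s(a, b), s(a, c), s(a, d), s(b, c), s(b, d), s(c, d)} : Finset (Sym2 V)))
    (hru : r = u ∨ s(r, u) ∈ ({s(a, b), s(a, c), s(a, d), s(b, c), s(b, d), s(c, d)} : Finset (Sym2 V))) :
    (∑ G ∈ D.powerset.filter (fun G =>
        (fromEdgeSet ((G ∪ K : Finset (Sym2 V)) : Set (Sym2 V))).IsAcyclic ∧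
        (fromEdgeSet ((G ∪ K : Finset (Sym2 V)) : Set (Sym2 V))).Reachable p q), ∏ x ∈ G, w x) *
      (∑ G ∈ D.powerset.filter (fun G =>
        (fromEdgeSet ((G ∪ K : Finset (Sym2 V)) : Set (Sym2 V))).IsAcyclic ∧
        (fromEdgeSet ((G ∪ K : Finset (Sym2 V)) : Set (Sym2 V))).Reachable r u), ∏ x ∈ G, w x) ≤
    (∑ G ∈ D.powerset.filter (fun G =>
        (fromEdgeSet ((G ∪ K : Finset (Sym2 V)) : Set (Sym2 V))).IsAcyclic), ∏ x ∈ G, w x) *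
      (∑ G ∈ D.powerset.filter (fun G =>
        (fromEdgeSet ((G ∪ K : Finset (Sym2 V)) : Set (Sym2 V))).IsAcyclic ∧
        ((fromEdgeSet ((G ∪ K : Finset (Sym2 V)) : Set (Sym2 V))).Reachable p q ∧
         (fromEdgeSet ((G ∪ K : Finset (Sym2 V)) : Set (Sym2 V))).Reachable r u)), ∏ x ∈ G, w x) :=
  forestsW_conn_posCorr_of_rayleigh _ (K4edges_not_isDiag a b c d hab hac had hbc hbd hcd)
    (forestsW_rayleigh_K4 a b c d hab hac had hbc hbd hcd) w hw D K hDK hsub hpq hru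

/-- **Negative correlation of the uniform random spanning forest on four vertices** (counting
form): for distinct `a b c d`, every `E ⊆ {ab,…,cd}` and edges `e ≠ f` of `E`,
`#{F : e,f ∈ F}·#F ≤ #{F : e ∈ F}·#{F : f ∈ F}` over the forests `F ⊆ E`. [Grimmett–Winkler 2004
(numerically, n ≤ 8); here a kernel proof for `n = 4` with `forestsW_rayleigh_K4`] -/
theorem forests_negCorr_K4 (a b c d : V) (hab : a ≠ b) (hac : a ≠ c) (had : a ≠ d) (hbc : b ≠ c)
    (hbd : b ≠ d) (hcd : c ≠ d) (E : Finset (Sym2 V))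
    (hE : E ⊆ ({s(a, b), s(a, c), s(a, d), s(b, c), s(b, d), s(c, d)} : Finset (Sym2 V))) {e f : Sym2 V}
    (he : e ∈ E) (hf : f ∈ E) (hef : e ≠ f) :
    #(E.powerset.filter fun F : Finset (Sym2 V) =>
        (fromEdgeSet ((F : Finset (Sym2 V)) : Set (Sym2 V))).IsAcyclic ∧ e ∈ F ∧ f ∈ F) *
      #(E.powerset.filter fun F : Finset (Sym2 V) =>
        (fromEdgeSet ((F : Finset (Sym2 V)) : Set (Sym2 V))).IsAcyclic) ≤
    #(E.powerset.filter fun F : Finset (Sym2 V) =>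
        (fromEdgeSet ((F : Finset (Sym2 V)) : Set (Sym2 V))).IsAcyclic ∧ e ∈ F) *
      #(E.powerset.filter fun F : Finset (Sym2 V) =>
        (fromEdgeSet ((F : Finset (Sym2 V)) : Set (Sym2 V))).IsAcyclic ∧ f ∈ F) :=
  forests_negCorr_of_rayleigh _ (forestsW_rayleigh_K4 a b c d hab hac had hbc hbd hcd) E hE he hf hef

end Summit.CriticalPhenomena.PercolationContinuityZ3.Theorems.ForestRayleigh
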